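import Summits.Ventures.YMGap.FlowData.CircleSpectralResolution
import Summits.Ventures.LatticeQCDFlow.Scoring.FinitePiSeriesProduct
import HarnessLib

/-!
# Venture YMGap, track Y3 FLOW-DATA — the TRACE FORMULA on the two-dimensional torus: the Wilson partition function of
# `ℤ_{L₀} × (ℤ/L)¹` through the circle transfer kernel is `Σ_n (c_n(β)/(n+1))^{L·L₀}` (theorems only)

HONEST FRAMING: venture file of the cell `pub-ymgap` (QuantumFields programme), track Y3; companion THEOREMS for
`FlowData/TubeTransferOperator.lean` (STEP-0 in theorem form: the exactly solvable two-dimensional case in the transfer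
vocabulary of the typed tube objects).  Finite tori only; no number, no row, nothing about limits, `k ≥ 2` or a mass gap.
NO Peter–Weyl: the circle slice kernel is expanded directly (`su2_sliceKernel_sliceOne_eq_tsum`) and only the Haar
ORTHONORMALITY of the holonomy characters (`integral_holCharacter_mul_holCharacter`) is used around the time circle.

* **`su2_integral_prod_sliceKernel_sliceOne_eq_tsum`** — THE CYCLIC KERNEL CHAIN: for `β > 0`, `L, L₀ ≥ 1`,
  `∫ ∏_{t ∈ ℤ_{L₀}} K(V_t, V_{t+1}) dV = Σ_n ((c_n(β)/(n+1))^L)^{L₀}` (`K = sliceKernel ρ (β/2) (β/2)` on the circle,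
  `c_n(β) = I_n(β) − I_{n+2}(β)`): the path-space form of `Tr T^{L₀} = Σ_n λ_n^{L₀}` — expand every kernel, integrate the
  `L₀` slices out by orthonormality (the representation is constant around the time circle);
* **`su2_twoDim_partitionFunction_eq_tsum`** — with the tree's transfer-matrix representation of the periodic-time
  Wilson ensemble (`SlabTransferKernel.integral_obs_mul_weight_eq_integral_sliceKernel`): the un-normalised Wilson
  partition function of SU(2) on the torus `ℤ_{L₀} × (ℤ/L)¹` with coupling `β/2` in front of `Re tr` on every plaquette is
  `∫ e^{−S} dU = Σ_n (c_n(β)/(n+1))^{L·L₀} = Σ_n (2 I_{n+1}(β)/β)^{L·L₀}` (Migdal's formula; `L·L₀` plaquettes).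

References: A. A. Migdal, Sov. Phys. JETP 42 (1975) 413; I. Montvay, G. Münster (1994) §3.2.6
[cite: MontvayMunster1994, §3.2.6]; K. Osterwalder, E. Seiler, Ann. Phys. 110 (1978) 440 §§2–3
[cite: OsterwalderSeilerAnnPhys1978, §3].
-/

noncomputable section

open scoped BigOperators Topology
open MeasureTheory Filter Function Set Polynomial.Chebyshev
open Literature.MathematicalPhysics.QuantumFieldTheory Literature.MathematicalPhysics.QuantumLattice Literature.Analysis.FunctionSpaces
open Literature.Barriers.QuantumFields
open Summit.Ventures.LatticeQCDFlow.Exactness Summit.Ventures.LatticeQCDFlow.Scoring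

namespace Summit.Ventures.YMGap.FlowData

section Trace

open Literature.MathematicalPhysics.QuantumLattice (fundamentalRep continuous_fundamentalRep)

variable {L : ℕ} [NeZero L]

/-- A sequence on the cycle `ℤ_{m+1}` that agrees with its shift is constant. [folklore] -/
theorem zmod_const_of_forall_eq_sub_one {m : ℕ} {x : ZMod (m + 1) → ℕ} (h : ∀ s, x s = x (s - 1)) (s : ZMod (m + 1)) :
    x s = x 0 := by
  have key : ∀ k : ℕ, x (k : ZMod (m + 1)) = x 0 := by
    intro k
    induction k with
    | zero => rw [Nat.cast_zero]
    | succ k ih =>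
      rw [h, Nat.cast_succ, add_sub_cancel_right, ih]
  have hs : s = ((s.val : ℕ) : ZMod (m + 1)) := (ZMod.natCast_zmod_val s).symm
  rw [hs]
  exact key _

/-- The product formula `Σ'_{x : ι → ℕ} ∏_i f_i(x_i) = ∏_i Σ'_n f_i(n)` and the summability of the multi-series, for an
arbitrary finite index type (the tree's `summable_norm_prod_pi_and_tsum` transported along `ι ≃ Fin |ι|`). [folklore] -/
theorem summable_norm_prod_pi_and_tsum_fintype {ι : Type*} [Fintype ι] (f : ι → ℕ → ℝ)
    (hf : ∀ i, Summable fun n => ‖f i n‖) :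
    (Summable fun x : ι → ℕ => ‖∏ i, f i (x i)‖) ∧ ∑' x : ι → ℕ, ∏ i, f i (x i) = ∏ i, ∑' n, f i n := by
  classical
  set e : ι ≃ Fin (Fintype.card ι) := Fintype.equivFin ι with he
  have hfin := summable_norm_prod_pi_and_tsum (Fintype.card ι) (fun j => f (e.symm j)) (fun j => hf _)
  set Φ : (ι → ℕ) ≃ (Fin (Fintype.card ι) → ℕ) := Equiv.piCongrLeft' (fun _ : ι => ℕ) e with hΦ
  have hterm : ∀ x : ι → ℕ, ∏ j, f (e.symm j) ((Φ x) j) = ∏ i, f i (x i) := by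
    intro x
    simp only [hΦ, Equiv.piCongrLeft'_apply]
    exact e.symm.prod_comp (fun i => f i (x i))
  constructor
  · have h1 := (Φ.summable_iff (f := fun y : Fin (Fintype.card ι) → ℕ => ‖∏ j, f (e.symm j) (y j)‖)).2 hfin.1
    refine h1.congr fun x => ?_
    simp only [comp_apply, hterm]
  · rw [← e.symm.prod_comp (fun i => ∑' n, f i n), ← hfin.2, ← Φ.tsum_eq (fun y => ∏ j, f (e.symm j) (y j))]
    exact tsum_congr fun x => (hterm x).symm

/-- **THE CYCLIC KERNEL CHAIN ON THE TWO-DIMENSIONAL TORUS.**  For `β > 0` and `L, L₀ ≥ 1`, integrating the product of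
circle slice kernels around the time circle gives the trace formula
`∫ ∏_{t ∈ ℤ_{L₀}} K(V_t, V_{t+1}) dV = Σ_n ((c_n(β)/(n+1))^L)^{L₀}`.  [cite: MontvayMunster1994, §3.2.6] -/
theorem su2_integral_prod_sliceKernel_sliceOne_eq_tsum {β : ℝ} (hβ : 0 < β) {L₀ : ℕ} [NeZero L₀] :
    ∫ V : ZMod L₀ → GaugeConfig 1 L (Matrix.specialUnitaryGroup (Fin 2) ℂ),
        ∏ t, sliceKernel (d := 1) (L := L) (fundamentalRep (Fin 2)) (β / 2) (β / 2) (V t) (V (t + 1))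
        ∂(Measure.pi fun _ : ZMod L₀ => sliceMeasure (Matrix.specialUnitaryGroup (Fin 2) ℂ) 1 L) =
      ∑' n : ℕ, (((besselI n β - besselI (n + 2) β) / (n + 1)) ^ L) ^ L₀ := by
  haveI : SecondCountableTopology (Matrix.specialUnitaryGroup (Fin 2) ℂ) :=
    Summit.Ventures.LatticeQCDFlow.Scoring.secondCountableTopology_su2
  obtain ⟨m, rfl⟩ : ∃ m, L₀ = m + 1 := Nat.exists_eq_succ_of_ne_zero (NeZero.ne L₀)
  set φf : ℕ → GaugeConfig 1 L (Matrix.specialUnitaryGroup (Fin 2) ℂ) → ℝ := fun n b =>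
    (U ℝ n).eval (su2a0 (List.ofFn fun t : Fin L => b (Pi.single (0 : Fin 1) ((t : ℕ) : ZMod L), (0 : Fin 1))).prod)
    with hφf
  set ev : ℕ → ℝ := fun n => ((besselI n β - besselI (n + 2) β) / (n + 1)) ^ L with hev
  have hev0 : ∀ n, 0 ≤ ev n := eigenvalue_sliceOne_nonneg (L := L) hβ.le
  have hφb : ∀ n b, |φf n b| ≤ (n : ℝ) + 1 := fun n b => abs_holCharacter_le (L := L) n b
  -- the kernel as a character series
  have hK : ∀ a b : GaugeConfig 1 L (Matrix.specialUnitaryGroup (Fin 2) ℂ),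
      sliceKernel (d := 1) (L := L) (fundamentalRep (Fin 2)) (β / 2) (β / 2) a b =
        ∑' n : ℕ, ev n * (φf n a * φf n b) := fun a b => su2_sliceKernel_sliceOne_eq_tsum hβ.le a b
  -- Step 1: the product of the `m+1` kernel series is one multi-series
  have hstep1 : ∀ V : ZMod (m + 1) → GaugeConfig 1 L (Matrix.specialUnitaryGroup (Fin 2) ℂ),
      ∏ t, sliceKernel (d := 1) (L := L) (fundamentalRep (Fin 2)) (β / 2) (β / 2) (V t) (V (t + 1)) =
        ∑' x : ZMod (m + 1) → ℕ, ∏ t, ev (x t) * (φf (x t) (V t) * φf (x t) (V (t + 1))) := by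
    intro V
    simp_rw [hK]
    refine ((summable_norm_prod_pi_and_tsum_fintype
      (fun (t : ZMod (m + 1)) (n : ℕ) => ev n * (φf n (V t) * φf n (V (t + 1)))) fun t => ?_).2).symm
    refine Summable.of_nonneg_of_le (fun n => norm_nonneg _) (fun n => ?_) (summable_eigenvalue_sliceOne_mul_sq (L := L) hβ)
    rw [Real.norm_eq_abs, abs_mul, abs_mul, abs_of_nonneg (hev0 n), sq]
    exact mul_le_mul_of_nonneg_left (mul_le_mul (hφb n _) (hφb n _) (abs_nonneg _) (by positivity)) (hev0 n)
  simp_rw [hstep1]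
  -- Step 2: integrate term by term
  have hbound : ∀ (x : ZMod (m + 1) → ℕ) (V : ZMod (m + 1) → GaugeConfig 1 L (Matrix.specialUnitaryGroup (Fin 2) ℂ)),
      ‖∏ t, ev (x t) * (φf (x t) (V t) * φf (x t) (V (t + 1)))‖ ≤ ∏ t, ev (x t) * ((x t : ℝ) + 1) ^ 2 := by
    intro x V
    rw [norm_prod]
    refine Finset.prod_le_prod (fun t _ => norm_nonneg _) fun t _ => ?_
    rw [Real.norm_eq_abs, abs_mul, abs_mul, abs_of_nonneg (hev0 _), sq]
    exact mul_le_mul_of_nonneg_left (mul_le_mul (hφb _ _) (hφb _ _) (abs_nonneg _) (by positivity)) (hev0 _)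
  have hcont : ∀ x : ZMod (m + 1) → ℕ, Continuous fun V : ZMod (m + 1) → GaugeConfig 1 L (Matrix.specialUnitaryGroup (Fin 2) ℂ) =>
      ∏ t, ev (x t) * (φf (x t) (V t) * φf (x t) (V (t + 1))) := fun x =>
    continuous_finsetProd _ fun t _ => continuous_const.mul
      (((continuous_holCharacter (x t)).comp (continuous_apply t)).mul
        ((continuous_holCharacter (x t)).comp (continuous_apply (t + 1))))
  have hint : ∀ x : ZMod (m + 1) → ℕ, Integrable (fun V : ZMod (m + 1) → GaugeConfig 1 L (Matrix.specialUnitaryGroup (Fin 2) ℂ) =>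
      ∏ t, ev (x t) * (φf (x t) (V t) * φf (x t) (V (t + 1))))
      (Measure.pi fun _ : ZMod (m + 1) => sliceMeasure (Matrix.specialUnitaryGroup (Fin 2) ℂ) 1 L) := fun x =>
    (hcont x).integrable_of_hasCompactSupport (HasCompactSupport.of_compactSpace _)
  have hsumx : Summable fun x : ZMod (m + 1) → ℕ => ‖∏ t, ev (x t) * ((x t : ℝ) + 1) ^ 2‖ :=
    (summable_norm_prod_pi_and_tsum_fintype (fun (_ : ZMod (m + 1)) (n : ℕ) => ev n * ((n : ℝ) + 1) ^ 2) fun _ =>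
      (summable_eigenvalue_sliceOne_mul_sq (L := L) hβ).norm).1
  have hnormsum : Summable fun x : ZMod (m + 1) → ℕ =>
      ∫ V, ‖∏ t, ev (x t) * (φf (x t) (V t) * φf (x t) (V (t + 1)))‖
        ∂(Measure.pi fun _ : ZMod (m + 1) => sliceMeasure (Matrix.specialUnitaryGroup (Fin 2) ℂ) 1 L) := by
    refine Summable.of_nonneg_of_le (fun x => integral_nonneg fun V => norm_nonneg _) (fun x => ?_) hsumx
    calc ∫ V, ‖∏ t, ev (x t) * (φf (x t) (V t) * φf (x t) (V (t + 1)))‖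
          ∂(Measure.pi fun _ : ZMod (m + 1) => sliceMeasure (Matrix.specialUnitaryGroup (Fin 2) ℂ) 1 L)
        ≤ ∫ _V, ∏ t, ev (x t) * ((x t : ℝ) + 1) ^ 2
          ∂(Measure.pi fun _ : ZMod (m + 1) => sliceMeasure (Matrix.specialUnitaryGroup (Fin 2) ℂ) 1 L) :=
          integral_mono_of_nonneg (Eventually.of_forall fun V => norm_nonneg _) (integrable_const _)
            (Eventually.of_forall (hbound x))
      _ = ∏ t, ev (x t) * ((x t : ℝ) + 1) ^ 2 := by rw [integral_const, probReal_univ, one_smul]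
      _ ≤ ‖∏ t, ev (x t) * ((x t : ℝ) + 1) ^ 2‖ := Real.le_norm_self _
  rw [← integral_tsum_of_summable_integral_norm hint hnormsum]
  -- Step 3: each term, slice by slice, by orthonormality
  have hterm : ∀ x : ZMod (m + 1) → ℕ,
      ∫ V, ∏ t, ev (x t) * (φf (x t) (V t) * φf (x t) (V (t + 1)))
        ∂(Measure.pi fun _ : ZMod (m + 1) => sliceMeasure (Matrix.specialUnitaryGroup (Fin 2) ℂ) 1 L) =
        (∏ t, ev (x t)) * ∏ t : ZMod (m + 1), (if x t = x (t - 1) then (1 : ℝ) else 0) := by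
    intro x
    have hre : ∀ V : ZMod (m + 1) → GaugeConfig 1 L (Matrix.specialUnitaryGroup (Fin 2) ℂ),
        ∏ t, ev (x t) * (φf (x t) (V t) * φf (x t) (V (t + 1))) =
          (∏ t, ev (x t)) * ∏ t, (φf (x t) (V t) * φf (x (t - 1)) (V t)) := by
      intro V
      rw [Finset.prod_mul_distrib, Finset.prod_mul_distrib, Finset.prod_mul_distrib]
      congr 2
      exact (Fintype.prod_equiv (Equiv.subRight (1 : ZMod (m + 1))) _ _ fun t => by
        simp only [Equiv.subRight_apply, sub_add_cancel]).symm
    simp_rw [hre]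
    rw [integral_const_mul]
    congr 1
    rw [integral_fintype_prod_eq_prod (fun (t : ZMod (m + 1)) (b : GaugeConfig 1 L (Matrix.specialUnitaryGroup (Fin 2) ℂ)) =>
      φf (x t) b * φf (x (t - 1)) b)]
    exact Finset.prod_congr rfl fun t _ => integral_holCharacter_mul_holCharacter (L := L) (x t) (x (t - 1))
  simp_rw [hterm]
  -- Step 4: only constant multi-indices survive
  have hind : ∀ x : ZMod (m + 1) → ℕ, (∏ t : ZMod (m + 1), (if x t = x (t - 1) then (1 : ℝ) else 0)) =
      if (∀ t, x t = x 0) then 1 else 0 := by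
    intro x
    by_cases h : ∀ t, x t = x 0
    · rw [if_pos h]
      exact Finset.prod_eq_one fun t _ => by rw [h t, h (t - 1), if_pos rfl]
    · rw [if_neg h]
      have h' : ∃ t, x t ≠ x (t - 1) := by
        by_contra hne
        exact h fun s => zmod_const_of_forall_eq_sub_one (fun t => not_not.1 (not_exists.1 hne t)) s
      obtain ⟨t, ht⟩ := h'
      exact Finset.prod_eq_zero (Finset.mem_univ t) (if_neg ht)
  simp_rw [hind, mul_ite, mul_one, mul_zero]
  symm
  rw [← Function.Injective.tsum_eq (g := fun n : ℕ => fun _ : ZMod (m + 1) => n)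
    (fun a b hab => by simpa using congr_fun hab 0) ?_]
  · refine tsum_congr fun n => ?_
    simp only [forall_const, if_true, Finset.prod_const, Finset.card_univ, ZMod.card]
    rfl
  · intro x hx
    rw [Function.mem_support] at hx
    have hc : ∀ t, x t = x 0 := by
      by_contra h
      exact hx (if_neg h)
    exact ⟨x 0, funext fun t => (hc t).symm⟩

/-- **THE TWO-DIMENSIONAL WILSON PARTITION FUNCTION THROUGH THE TRANSFER KERNEL** (STEP-0 in theorem form): for SU(2)
on the torus `ℤ_{L₀} × (ℤ/L)¹` with coupling `β/2` in front of `Re tr` on every plaquette (`β = β_W > 0`),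
`∫ e^{−S_W} dU = Σ_n (c_n(β)/(n+1))^{L·L₀}`, `c_n(β)/(n+1) = 2 I_{n+1}(β)/β` (Migdal): the tree's transfer-matrix
representation `∫ e^{−S} = ∫ ∏_t K(V_t, V_{t+1}) dV` followed by the cyclic kernel chain. [cite: MontvayMunster1994, §3.2.6] -/
theorem su2_twoDim_partitionFunction_eq_tsum {β : ℝ} (hβ : 0 < β) (L₀ L : ℕ) [NeZero L₀] [NeZero L] :
    ∫ U, FiniteTemperature.weight (fundamentalRep (Fin 2)) (β / 2) (β / 2) U
        ∂FiniteTemperature.haar 1 L₀ L (Matrix.specialUnitaryGroup (Fin 2) ℂ) =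
      ∑' n : ℕ, ((besselI n β - besselI (n + 2) β) / (n + 1)) ^ (L * L₀) := by
  haveI : SecondCountableTopology (Matrix.specialUnitaryGroup (Fin 2) ℂ) :=
    Summit.Ventures.LatticeQCDFlow.Scoring.secondCountableTopology_su2
  have h := integral_obs_mul_weight_eq_integral_sliceKernel (d := 1) (L₀ := L₀) (L := L)
    (fundamentalRep (Fin 2)) (continuous_fundamentalRep (Fin 2)) (β / 2) (β / 2) (fun _ => (1 : ℝ)) continuous_const
  simp only [one_mul] at h
  rw [h, su2_integral_prod_sliceKernel_sliceOne_eq_tsum (L := L) hβ]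
  exact tsum_congr fun n => by rw [← pow_mul]

end Trace

end Summit.Ventures.YMGap.FlowData
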